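import Mathlib.RepresentationTheory.Semisimple
import Mathlib.LinearAlgebra.Projection
import Mathlib.RingTheory.SimpleModule.Basic
import Mathlib.RingTheory.Adjoin.Basic
import Literature.NumberTheory.Automorphic.HeckeFixedVectorsSpan
import HarnessLib

/-!
# `K`-fixed vectors of a semisimple representation form a semisimple Hecke module

Topic `NumberTheory/Automorphic`; namespace `Literature.NumberTheory.Automorphic`.  Sequel to `HeckeFixedVectorsSpan`.
THEOREMS ONLY: no definition, no named fact, no instance, no `sorry`; no topology, no Haar measure.

## Source, as printed

Bushnell–Henniart, *The local Langlands conjecture for GL(2)* (2006), §4.2 Lemma and §4.3 (the functor `V ↦ V^K = e_K V` from smooth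
representations to `ℋ(G,K)`-modules is exact and compatible with direct sums), §4.4; Bump, *Automorphic Forms and Representations* (1997),
Prop. 4.2.3 and §3.3; Cartier, Corvallis 1979, §IV.1.  The statement formalised — a `G`-STABLE direct-sum decomposition `V = V₁ ⊕ V₂`
restricts to `V^K = V₁^K ⊕ V₂^K` with Hecke-stable summands, hence every Hecke-stable subspace of `V^K` of a SEMISIMPLE `V` has a Hecke-stable
complement — is the folklore consequence used to read «`H = ⊕_π m(π) π` ⇒ `H^K = ⊕_π m(π) π^K` as Hecke modules» (e.g. [Liu2021] p. 133 (D.3)).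

## What is formalised (theorems only)

`k` a field of characteristic zero, `K ≤ G` with all double cosets finite unions of left cosets (`hfin`), `σ` a representation on `V`.

* §1 `G`-stable decompositions and `K`-fixed vectors: `projection_apply_apply` (the projection of a `G`-stable decomposition commutes with
  `G`), `projection_mem_fixedPoints` (components of a `K`-fixed vector are `K`-fixed), `mem_of_mem_fixedPoints_of_isCompl` (if `V₂^K = 0`
  every `K`-fixed vector lies in `V₁`), `isCompl_toSubmodule`.
* §2 **`exists_heckeStable_compl`** — for `σ` SEMISIMPLE (Mathlib `Representation.IsSemisimpleRepresentation`) and a Hecke-stable `N ≤ V^K`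
  there is a Hecke-stable `C ≤ V^K` with `N ⊓ C = ⊥`, `N ⊔ C = V^K` (`C := U′ ∩ V^K` for a `G`-complement `U′` of the `G`-span of `N`, whose
  `K`-part is `N` by `HeckeFixedVectorsSpan`).
* §3 **packaging over the generated algebra** (pure linear algebra): `isSemisimpleModule_adjoin_of_forall_exists_isCompl` — if every
  `S`-stable subspace of a `k`-space `M` has an `S`-stable complement then `M` is a semisimple module over `k[S] = Algebra.adjoin k S ≤ End_k M`
  (the currency of `IsSemisimpleModule ↥(Algebra.adjoin _ (Set.range _)) _` hypotheses).

Cell note (hodgecm-mathlib, crux `HLiu418` = stmt-HodgeConjecture-24832, d6 line): with a `G`-level semisimplicity fact (print (D.3)) these make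
the LEVEL-WISE semisimplicity `S1cShape` a theorem; count-neutral; HC_CM is proved only modulo the 7 printed citations until rung 0 closes.

## References
* [BushnellHenniart2006] C. J. Bushnell, G. Henniart, *The Local Langlands Conjecture for GL(2)*, Grundlehren 335 (2006), §4.2 Lemma (p. 35),
  §4.3–4.4.
* [Bump1997] D. Bump, *Automorphic Forms and Representations*, Cambridge Stud. Adv. Math. 55 (1997), Prop. 4.2.3 (p. 427).
* [Liu2021] Y. Liu, *Fourier–Jacobi cycles and arithmetic relative trace formula*, Camb. J. Math. 9 (2021), p. 133 (D.3).
-/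

noncomputable section

open MulAction

namespace Literature.NumberTheory.Automorphic

/-! ## §1 `G`-stable decompositions and `K`-fixed vectors -/

section Decomposition

variable {k G V : Type*} [Field k] [Group G] [AddCommGroup V] [Module k V] (σ : Representation k G V) (K : Subgroup G)

/-- A `G`-stable decomposition `V = V₁ ⊕ V₂`: the projection onto `V₁` along `V₂` commutes with `G`.
[cite: BushnellHenniart2006, §4.3] -/
theorem projection_apply_apply (V₁ V₂ : Subrepresentation σ) (h : IsCompl V₁.toSubmodule V₂.toSubmodule) (g : G) (v : V) :
    V₁.toSubmodule.projection V₂.toSubmodule h (σ g v) = σ g (V₁.toSubmodule.projection V₂.toSubmodule h v) := by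
  have hdec := Submodule.projection_add_projection_eq_self h v
  set a := V₁.toSubmodule.projection V₂.toSubmodule h v with ha
  set b := V₂.toSubmodule.projection V₁.toSubmodule h.symm v with hb
  have haM : σ g a ∈ V₁.toSubmodule := V₁.apply_mem_toSubmodule g (Submodule.projection_apply_mem h v)
  have hbM : σ g b ∈ V₂.toSubmodule := V₂.apply_mem_toSubmodule g (Submodule.projection_apply_mem h.symm v)
  conv_lhs => rw [← hdec, map_add]
  rw [map_add, Submodule.projection_apply_of_mem_left h haM, Submodule.projection_apply_of_mem_right h hbM, add_zero]

/-- In a `G`-stable decomposition the components of a `K`-fixed vector are `K`-fixed («`V ↦ V^K` is additive»).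
[cite: BushnellHenniart2006, §4.3] -/
theorem projection_mem_fixedPoints (V₁ V₂ : Subrepresentation σ) (h : IsCompl V₁.toSubmodule V₂.toSubmodule) {v : V}
    (hv : v ∈ σ.fixedPoints K) : V₁.toSubmodule.projection V₂.toSubmodule h v ∈ σ.fixedPoints K := by
  rw [Representation.mem_fixedPoints] at hv ⊢
  intro g hg
  rw [← projection_apply_apply σ V₁ V₂ h g v, hv g hg]

/-- In a `G`-stable decomposition `V = V₁ ⊕ V₂` with `V₂^K = 0`, every `K`-fixed vector lies in `V₁`. [cite: BushnellHenniart2006, §4.3] -/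
theorem mem_of_mem_fixedPoints_of_isCompl (V₁ V₂ : Subrepresentation σ) (h : IsCompl V₁.toSubmodule V₂.toSubmodule)
    (hV₂ : V₂.toSubmodule ⊓ σ.fixedPoints K = ⊥) {v : V} (hv : v ∈ σ.fixedPoints K) : v ∈ V₁.toSubmodule := by
  have hdec := Submodule.projection_add_projection_eq_self h v
  have hb0 : V₂.toSubmodule.projection V₁.toSubmodule h.symm v = 0 := by
    have : V₂.toSubmodule.projection V₁.toSubmodule h.symm v ∈ V₂.toSubmodule ⊓ σ.fixedPoints K :=
      ⟨Submodule.projection_apply_mem h.symm v, projection_mem_fixedPoints σ K V₂ V₁ h.symm hv⟩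
    rw [hV₂] at this
    exact (Submodule.mem_bot k).1 this
  rw [← hdec, hb0, add_zero]
  exact Submodule.projection_apply_mem h v

/-- `IsCompl` of subrepresentations is `IsCompl` of the underlying submodules. [cite: BushnellHenniart2006, §4.3] -/
theorem isCompl_toSubmodule {V₁ V₂ : Subrepresentation σ} (h : IsCompl V₁ V₂) :
    IsCompl V₁.toSubmodule V₂.toSubmodule := by
  refine ⟨?_, ?_⟩
  · rw [disjoint_iff]
    exact congrArg Subrepresentation.toSubmodule (disjoint_iff.1 h.1)
  · rw [codisjoint_iff]
    exact congrArg Subrepresentation.toSubmodule (codisjoint_iff.1 h.2)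

end Decomposition

/-! ## §2 Hecke-stable complements in `V^K` for a semisimple `V` -/

section Compl

variable {k G V : Type*} [Field k] [CharZero k] [Group G] [AddCommGroup V] [Module k V] (σ : Representation k G V) (K : Subgroup G)

/-- **Every Hecke-stable subspace of `V^K` has a Hecke-stable complement in `V^K` when `V` is semisimple** (the functor
`V ↦ V^K` carries the `G`-decomposition `V = U ⊕ U′`, `U =` the `G`-span of `N`, to `V^K = N ⊕ (U′)^K`: the `K`-part of the `G`-span of a
Hecke-stable `N` is `N`, Bushnell–Henniart §4.2 Lemma, and components of `K`-fixed vectors are `K`-fixed).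
[cite: BushnellHenniart2006, §4.2 Lemma (p. 35)] [cite: Bump1997, Prop. 4.2.3] -/
theorem exists_heckeStable_compl [σ.IsSemisimpleRepresentation] (hfin : ∀ g : G, (orbit K (g : G ⧸ K)).Finite)
    {N : Submodule k V} (hNK : N ≤ σ.fixedPoints K) (hN : ∀ g : G, ∀ n ∈ N, heckeOperator σ K g n ∈ N) :
    ∃ C : Submodule k V, C ≤ σ.fixedPoints K ∧ (∀ g : G, ∀ c ∈ C, heckeOperator σ K g c ∈ C) ∧ N ⊓ C = ⊥ ∧ N ⊔ C = σ.fixedPoints K := by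
  classical
  -- the `G`-span `U` of `N` and a `G`-complement `U′`
  set U : Subrepresentation σ := ⟨Submodule.span k (⋃ g : G, σ g '' (N : Set V)),
    fun g x hx => map_span_translates_le σ N g (Submodule.mem_map_of_mem hx)⟩ with hU
  have hUK : U.toSubmodule ⊓ σ.fixedPoints K = N := span_translates_inf_fixedPoints_of_stable σ K hfin hNK hN
  obtain ⟨U', hc⟩ := exists_isCompl U
  have hc' : IsCompl U.toSubmodule U'.toSubmodule := isCompl_toSubmodule σ hc
  refine ⟨U'.toSubmodule ⊓ σ.fixedPoints K, inf_le_right, fun g c hc => ?_, ?_, ?_⟩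
  · -- Hecke-stable: `[KgK] c = ∑ σ(y) c ∈ U′`, and it is `K`-fixed
    refine ⟨?_, heckeOperator_apply_mem_fixedPoints σ K g hc.2 (hfin g)⟩
    change heckeOperator σ K g c ∈ U'.toSubmodule
    rw [heckeOperator_apply_eq_sum_out σ K g (hfin g) hc.2]
    exact Submodule.sum_mem _ fun α _ => U'.apply_mem_toSubmodule _ hc.1
  · -- disjoint: `N ⊓ C ≤ U ⊓ U′ = ⊥`
    rw [eq_bot_iff]
    rintro x ⟨hxN, hxU', -⟩
    have hxU : x ∈ U.toSubmodule := le_span_translates σ N hxN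
    have : x ∈ U.toSubmodule ⊓ U'.toSubmodule := ⟨hxU, hxU'⟩
    rwa [hc'.inf_eq_bot] at this
  · -- spanning: decompose a `K`-fixed `v` along `U ⊕ U′`; both components are `K`-fixed
    refine le_antisymm (sup_le hNK inf_le_right) fun v hv => ?_
    have hdec := Submodule.projection_add_projection_eq_self hc' v
    rw [← hdec]
    refine Submodule.add_mem_sup ?_ ?_
    · rw [← hUK]
      exact ⟨Submodule.projection_apply_mem hc' v, projection_mem_fixedPoints σ K U U' hc' hv⟩
    · exact ⟨Submodule.projection_apply_mem hc'.symm v, projection_mem_fixedPoints σ K U' U hc'.symm hv⟩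

end Compl

/-! ## §3 Packaging: stable complements make a semisimple module over the generated algebra -/

section Adjoin

variable {k M : Type*} [Field k] [AddCommGroup M] [Module k M]

/-- An `Algebra.adjoin k S`-submodule of `M` is an `S`-stable subspace. [cite: Bump1997, Prop. 4.2.3] -/
theorem forall_mem_restrictScalars_of_submodule_adjoin (S : Set (Module.End k M)) (N : Submodule (Algebra.adjoin k S) M) :
    ∀ s ∈ S, ∀ n ∈ N.restrictScalars k, s n ∈ N.restrictScalars k := by
  intro s hs n hn
  have : (⟨s, Algebra.subset_adjoin hs⟩ : Algebra.adjoin k S) • n ∈ N := N.smul_mem _ hn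
  exact this

/-- An `S`-stable subspace of `M` is (the restriction of scalars of) an `Algebra.adjoin k S`-submodule. [cite: Bump1997, Prop. 4.2.3] -/
theorem exists_submodule_adjoin_of_forall_mem (S : Set (Module.End k M)) (C : Submodule k M) (hC : ∀ s ∈ S, ∀ c ∈ C, s c ∈ C) :
    ∃ C' : Submodule (Algebra.adjoin k S) M, C'.restrictScalars k = C := by
  refine ⟨⟨C.toAddSubmonoid, fun r c hc => ?_⟩, rfl⟩
  change (r : Module.End k M) c ∈ C
  obtain ⟨r, hr⟩ := r
  induction hr using Algebra.adjoin_induction generalizing c with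
  | mem x hx => exact hC x hx c hc
  | algebraMap a => simpa using C.smul_mem a hc
  | add x y _ _ hx hy => simpa using C.add_mem (hx c hc) (hy c hc)
  | mul x y _ _ hx hy => simpa using hx _ (hy c hc)

/-- **Stable complements ⇒ semisimple module over the generated algebra.**  If every `S`-stable `k`-subspace of `M` has an `S`-stable
complement, then `M` is a semisimple module over `k[S] = Algebra.adjoin k S ≤ End_k M`. [cite: Bump1997, Prop. 4.2.3] -/
theorem isSemisimpleModule_adjoin_of_forall_exists_isCompl (S : Set (Module.End k M))
    (h : ∀ N : Submodule k M, (∀ s ∈ S, ∀ n ∈ N, s n ∈ N) → ∃ C : Submodule k M, (∀ s ∈ S, ∀ c ∈ C, s c ∈ C) ∧ IsCompl N C) :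
    IsSemisimpleModule (Algebra.adjoin k S) M := by
  rw [isSemisimpleModule_iff]
  refine ⟨fun N => ?_⟩
  obtain ⟨C, hCS, hNC⟩ := h (N.restrictScalars k) (forall_mem_restrictScalars_of_submodule_adjoin S N)
  obtain ⟨C', rfl⟩ := exists_submodule_adjoin_of_forall_mem S C hCS
  exact ⟨C', (Submodule.isCompl_restrictScalars_iff (S := k)).1 hNC⟩

end Adjoin

end Literature.NumberTheory.Automorphic
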